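import Summits.Ventures.HodgeRepro2.T5InertPrincipalSeries
import Summits.Ventures.HodgeRepro2.T5InertSatakeTransform

/-!
# The spherical Hecke eigenvalue of the unramified principal series: `χ_π(T₁) = q²(α + α⁻¹) + (q − 1)`
(cell pub-hodge-repro2, seat p3)

Tier-5 N3 support — THE MACDONALD–SATAKE IDENTIFICATION (the last sentence of T5-SATAKE-KERNEL-p3.md's chain):
for the spherical vector `f₀` of the unramified principal series `I(c)` (`c = (χ δ_B^{1/2})(a₁) = α q^{−2}`),
`T₁ f₀ = λ f₀` with `λ = (T₁ f₀)(1) = ∑_{xK ⊆ K a₁ K} f₀(x)`; grouping the cosets by the `m` with `x ∈ N a_m K`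
(file 215's `iwasawaPiece`, disjoint, of sizes `satakeCount 1 m` = `q⁴, q − 1, 1` for `m = 1, 0, −1` and `0`
otherwise) gives `λ = c q⁴ + (q − 1) + c⁻¹ = q² α + (q − 1) + q² α⁻¹`, i.e. `λ = ∑_m χ(a_m) S(T₁)(a_m)` with
file 213's `S(T₁) = q² X + (q − 1) + q² X⁻¹`. The Iwasawa decomposition `G = N {a_m} K` is the one input taken as
a hypothesis (`hIw`); everything else is in the tree.

* `orbit_cellU_one_eq_iUnion_iwasawaPiece` — `K a₁ K / K = iwasawaPiece (−1) ⊔ iwasawaPiece 0 ⊔ iwasawaPiece 1`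
  under `hIw`, the pieces pairwise disjoint and finite;
* **`heckeSMul_doubleCosetOp_apply_one_eq`** — `(T₁ f₀)(1) = c⁻¹ · 1 + c⁰ (q − 1) + c · q⁴`;
* **`heckeSMul_cellU_one_eq_smul`** — `T₁ f₀ = (c⁻¹ + (q − 1) + q⁴ c) • f₀`;
* **`heckeSMul_cellU_one_eq_smul_param`** — with `c = α q^{−2}`: `T₁ f₀ = (q² (α + α⁻¹) + (q − 1)) • f₀`.

Mathlib + this seat's files 216 / 213 and their imports; no display; no device.
§8(d): uses an L-value-free non-vanishing device: NO.
-/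

namespace Summit.Ventures.HodgeRepro2.T5InertSphericalEigenvalue

open Summit.Ventures.HodgeRepro2.T5CartanCellsDistinct Summit.Ventures.HodgeRepro2.T5HeckeBasisCells
  Summit.Ventures.HodgeRepro2.T5HermitianThreeElements Summit.Ventures.HodgeRepro2.T5UnitaryGroupForm
  Summit.Ventures.HodgeRepro2.T5UnitaryHeckeAdjoint Summit.Ventures.HodgeRepro2.T5HeckePermutationModule
  Summit.Ventures.HodgeRepro2.T5HeckeDoubleCoset Summit.Ventures.HodgeRepro2.T5InertUnipotentResidue
  Summit.Ventures.HodgeRepro2.T5InertResidueInvolution Summit.Ventures.HodgeRepro2.T5InertUnipotentRadical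
  Summit.Ventures.HodgeRepro2.T5InertSatakeSets Summit.Ventures.HodgeRepro2.T5InertSatakeCounts
  Summit.Ventures.HodgeRepro2.T5InertSatakeTransform Summit.Ventures.HodgeRepro2.T5InertIwasawaCosets
  Summit.Ventures.HodgeRepro2.T5InertPrincipalSeries

section Pieces

variable {R E : Type*} [CommRing R] [IsDomain R] [IsDiscreteValuationRing R] [Field E] [StarRing E]
  [Algebra R E] [IsFractionRing R E] [Finite (IsLocalRing.ResidueField R)]
  (hstar : ∀ x : E, IsLocalization.IsInteger R x → IsLocalization.IsInteger R (star x))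
  (u : E) (hsu : star u = u) (hu0 : u ≠ 0) (hu : IsLocalization.IsInteger R u)
  (hu' : IsLocalization.IsInteger R u⁻¹) {ϖ : R} (hϖ : Irreducible ϖ)
  (hs : star (algebraMap R E ϖ) = algebraMap R E ϖ)

/-- Each piece is finite (it lies in the finite orbit `K a₁ K / K`). -/
theorem finite_iwasawaPiece (m : ℤ) : (iwasawaPiece (R := R) u hϖ hs m).Finite :=
  (Set.toFinite (MulAction.orbit (hyperspecialSubgroup R (J3 u)) ((cellU hϖ hs u 1 : formUnitaryGroup (J3 u)) :
    formUnitaryGroup (J3 u) ⧸ hyperspecialSubgroup R (J3 u)))).subset fun _ hx => hx.1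

include hstar hsu hu0 hu hu' in
/-- The pieces over distinct `m` are disjoint. -/
theorem disjoint_iwasawaPiece {m m' : ℤ} (h : m ≠ m') :
    Disjoint (iwasawaPiece (R := R) u hϖ hs m) (iwasawaPiece (R := R) u hϖ hs m') := by
  rw [Set.disjoint_left]
  rintro x ⟨-, n, hn, rfl⟩ ⟨-, n', hn', hx⟩
  rw [QuotientGroup.eq] at hx
  refine h (eq_of_mul_cellZ_mul_eq hstar u hsu hu0 hu hu' hϖ hs hn hn' (Subgroup.one_mem _)
    (Subgroup.inv_mem _ hx) ?_)
  group

include hstar hsu hu0 hu hu' in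
/-- A non-empty piece has `|m| ≤ 1`. -/
theorem abs_le_one_of_mem_iwasawaPiece {m : ℤ} {x : formUnitaryGroup (J3 u) ⧸ hyperspecialSubgroup R (J3 u)}
    (hx : x ∈ iwasawaPiece (R := R) u hϖ hs m) : -1 ≤ m ∧ m ≤ 1 := by
  by_contra h
  rw [iwasawaPiece_eq_image] at hx
  rcases (show 2 ≤ m ∨ m ≤ -2 by omega) with hm | hm
  · rw [satakeSet_one_of_two_le hstar u hsu hu0 hu hu' hϖ hs hm, Set.image_empty] at hx
    exact hx
  · rw [satakeSet_one_of_le_neg_two hstar u hsu hu0 hu hu' hϖ hs hm, Set.image_empty] at hx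
    exact hx

include hstar hsu hu0 hu hu' in
/-- **Under the Iwasawa decomposition, `K a₁ K / K` is the disjoint union of the three pieces `m = −1, 0, 1`.** -/
theorem orbit_cellU_one_eq_union
    (hIw : ∀ g : formUnitaryGroup (J3 u), ∃ n ∈ upperUnipotent u, ∃ m : ℤ, ∃ κ ∈ hyperspecialSubgroup R (J3 u),
      g = n * cellZ u hϖ hs m * κ) :
    MulAction.orbit (hyperspecialSubgroup R (J3 u)) ((cellU hϖ hs u 1 : formUnitaryGroup (J3 u)) :
        formUnitaryGroup (J3 u) ⧸ hyperspecialSubgroup R (J3 u)) =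
      (iwasawaPiece (R := R) u hϖ hs (-1) ∪ iwasawaPiece (R := R) u hϖ hs 0) ∪ iwasawaPiece (R := R) u hϖ hs 1 := by
  ext x
  constructor
  · intro hx
    obtain ⟨g, rfl⟩ := QuotientGroup.mk_surjective x
    obtain ⟨n, hn, m, κ, hκ, rfl⟩ := hIw g
    have hmem : ((n * cellZ u hϖ hs m * κ : formUnitaryGroup (J3 u)) :
        formUnitaryGroup (J3 u) ⧸ hyperspecialSubgroup R (J3 u)) ∈ iwasawaPiece (R := R) u hϖ hs m := by
      refine ⟨hx, n, hn, ?_⟩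
      rw [QuotientGroup.eq, show (n * cellZ u hϖ hs m * κ)⁻¹ * (n * cellZ u hϖ hs m) = κ⁻¹ by group]
      exact Subgroup.inv_mem _ hκ
    obtain ⟨h1, h2⟩ := abs_le_one_of_mem_iwasawaPiece hstar u hsu hu0 hu hu' hϖ hs hmem
    rcases (show m = -1 ∨ m = 0 ∨ m = 1 by omega) with rfl | rfl | rfl
    · exact Or.inl (Or.inl hmem)
    · exact Or.inl (Or.inr hmem)
    · exact Or.inr hmem
  · rintro ((hx | hx) | hx) <;> exact hx.1

end Pieces

/-! ## The eigenvalue -/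

section Eigenvalue

variable {R E : Type*} [CommRing R] [IsDomain R] [IsDiscreteValuationRing R] [Field E] [StarRing E]
  [Algebra R E] [IsFractionRing R E] [Finite (IsLocalRing.ResidueField R)]
  (hstar : ∀ x : E, IsLocalization.IsInteger R x → IsLocalization.IsInteger R (star x))
  (u : E) (hsu : star u = u) (hu0 : u ≠ 0) (hu : IsLocalization.IsInteger R u)
  (hu' : IsLocalization.IsInteger R u⁻¹) {ϖ : R} (hϖ : Irreducible ϖ)
  (hs : star (algebraMap R E ϖ) = algebraMap R E ϖ) (k : Type*) [Field k]
  [Finite (MulAction.orbit (hyperspecialSubgroup R (J3 u)) ((cellU hϖ hs u 1 : formUnitaryGroup (J3 u)) :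
    formUnitaryGroup (J3 u) ⧸ hyperspecialSubgroup R (J3 u)))]

omit [IsDomain R] [IsDiscreteValuationRing R] [Finite (IsLocalRing.ResidueField R)]
  [Finite (MulAction.orbit (hyperspecialSubgroup R (J3 u)) ((cellU hϖ hs u 1 : formUnitaryGroup (J3 u)) :
    formUnitaryGroup (J3 u) ⧸ hyperspecialSubgroup R (J3 u)))] in
/-- On the piece over `m`, `f₀` takes the value `c^m`. -/
theorem orbitMap_apply_one_of_mem_iwasawaPiece {c : k} {f₀ : formUnitaryGroup (J3 u) → k}
    (hf₀ : IsInduced u hϖ hs k c f₀) (hf₀K : f₀ ∈ LevelPositivity.invariants (rightRegular k) (hyperspecialSubgroup R (J3 u)))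
    (h1 : f₀ 1 = 1) {m : ℤ} {x : formUnitaryGroup (J3 u) ⧸ hyperspecialSubgroup R (J3 u)}
    (hx : x ∈ iwasawaPiece (R := R) u hϖ hs m) :
    orbitMap (rightRegular k) f₀ hf₀K x 1 = c ^ m := by
  obtain ⟨-, n, hn, rfl⟩ := hx
  rw [orbitMap_rightRegular_mk_apply_one, ← mul_one (n * cellZ u hϖ hs m),
    apply_mul_cellZ_mul hf₀ ((mem_invariants_rightRegular_iff k _ _).1 hf₀K) hn m (Subgroup.one_mem _), h1, mul_one]

omit [Finite (MulAction.orbit (hyperspecialSubgroup R (J3 u)) ((cellU hϖ hs u 1 : formUnitaryGroup (J3 u)) :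
    formUnitaryGroup (J3 u) ⧸ hyperspecialSubgroup R (J3 u)))] in
include hstar hsu hu0 hu in
/-- The sum of `f₀` over a piece is `satakeCount 1 m • c^m`. -/
theorem finsum_mem_iwasawaPiece {c : k} {f₀ : formUnitaryGroup (J3 u) → k}
    (hf₀ : IsInduced u hϖ hs k c f₀) (hf₀K : f₀ ∈ LevelPositivity.invariants (rightRegular k) (hyperspecialSubgroup R (J3 u)))
    (h1 : f₀ 1 = 1) (m : ℤ) :
    ∑ᶠ x ∈ iwasawaPiece (R := R) u hϖ hs m, orbitMap (rightRegular k) f₀ hf₀K x 1 =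
      (satakeCount hstar u hu' hϖ hs 1 m : k) * c ^ m := by
  rw [finsum_mem_congr rfl fun x hx => orbitMap_apply_one_of_mem_iwasawaPiece u hϖ hs k hf₀ hf₀K h1 hx,
    finsum_mem_eq_finite_toFinset_sum _ (finite_iwasawaPiece u hϖ hs m), Finset.sum_const,
    ← Set.ncard_eq_toFinset_card _ (finite_iwasawaPiece u hϖ hs m),
    ncard_iwasawaPiece_eq_satakeCount hstar u hsu hu0 hu hu' hϖ hs m, nsmul_eq_mul]

include hstar hsu hu0 hu hu' in
/-- **`(T₁ f₀)(1) = c⁻¹ + (q − 1) + Q q² c`** under the Iwasawa decomposition (`htr` for the counts). -/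
theorem heckeSMul_doubleCosetOp_apply_one_eq
    (hIw : ∀ g : formUnitaryGroup (J3 u), ∃ n ∈ upperUnipotent u, ∃ m : ℤ, ∃ κ ∈ hyperspecialSubgroup R (J3 u),
      g = n * cellZ u hϖ hs m * κ)
    (htr : ∃ e : R, algebraMap R E e + star (algebraMap R E e) = 1)
    {c : k} {f₀ : formUnitaryGroup (J3 u) → k} (hf₀ : IsInduced u hϖ hs k c f₀)
    (hf₀K : f₀ ∈ LevelPositivity.invariants (rightRegular k) (hyperspecialSubgroup R (J3 u))) (h1 : f₀ 1 = 1) :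
    (heckeSMul (rightRegular k) (doubleCosetOp k (hyperspecialSubgroup R (J3 u)) (cellU hϖ hs u 1)) ⟨f₀, hf₀K⟩ :
        formUnitaryGroup (J3 u) → k) 1 =
      c⁻¹ + ((Nat.card (traceZero R E) : k) - 1) +
        ((Nat.card (IsLocalRing.ResidueField R) : k) * (Nat.card (traceZero R E) : k) ^ 2) * c := by
  rw [heckeSMul_doubleCosetOp_apply, orbit_cellU_one_eq_union hstar u hsu hu0 hu hu' hϖ hs hIw,
    finsum_mem_union (Set.disjoint_union_left.2 ⟨disjoint_iwasawaPiece hstar u hsu hu0 hu hu' hϖ hs (by norm_num),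
      disjoint_iwasawaPiece hstar u hsu hu0 hu hu' hϖ hs (by norm_num)⟩)
      ((finite_iwasawaPiece u hϖ hs _).union (finite_iwasawaPiece u hϖ hs _)) (finite_iwasawaPiece u hϖ hs _),
    finsum_mem_union (disjoint_iwasawaPiece hstar u hsu hu0 hu hu' hϖ hs (by norm_num))
      (finite_iwasawaPiece u hϖ hs _) (finite_iwasawaPiece u hϖ hs _),
    finsum_mem_iwasawaPiece hstar u hsu hu0 hu hu' hϖ hs k hf₀ hf₀K h1,
    finsum_mem_iwasawaPiece hstar u hsu hu0 hu hu' hϖ hs k hf₀ hf₀K h1,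
    finsum_mem_iwasawaPiece hstar u hsu hu0 hu hu' hϖ hs k hf₀ hf₀K h1,
    satakeCount_one_neg_one hstar u hsu hu0 hu hu' hϖ hs, satakeCount_one_zero hstar u hsu hu0 hu hu' hϖ hs htr,
    satakeCount_one_one hstar u hsu hu0 hu hu' hϖ hs htr, Nat.cast_sub card_traceZero_pos, zpow_zero, zpow_one,
    _root_.zpow_neg_one]
  push_cast
  ring

include hstar hsu hu0 hu hu' in
/-- **The spherical vector is a `T₁`-eigenvector with eigenvalue `c⁻¹ + (q − 1) + Q q² c`.** -/
theorem heckeSMul_cellU_one_eq_smul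
    (hIw : ∀ g : formUnitaryGroup (J3 u), ∃ n ∈ upperUnipotent u, ∃ m : ℤ, ∃ κ ∈ hyperspecialSubgroup R (J3 u),
      g = n * cellZ u hϖ hs m * κ)
    (htr : ∃ e : R, algebraMap R E e + star (algebraMap R E e) = 1)
    {c : k} {f₀ : formUnitaryGroup (J3 u) → k} (hf₀ : IsInduced u hϖ hs k c f₀)
    (hf₀K : f₀ ∈ LevelPositivity.invariants (rightRegular k) (hyperspecialSubgroup R (J3 u))) (h1 : f₀ 1 = 1) :
    heckeSMul (rightRegular k) (doubleCosetOp k (hyperspecialSubgroup R (J3 u)) (cellU hϖ hs u 1)) ⟨f₀, hf₀K⟩ =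
      (c⁻¹ + ((Nat.card (traceZero R E) : k) - 1) +
        ((Nat.card (IsLocalRing.ResidueField R) : k) * (Nat.card (traceZero R E) : k) ^ 2) * c) • ⟨f₀, hf₀K⟩ := by
  rw [← heckeSMul_doubleCosetOp_apply_one_eq hstar u hsu hu0 hu hu' hϖ hs k hIw htr hf₀ hf₀K h1]
  exact heckeSMul_eq_smul_of_iwasawa hIw hf₀ hf₀K h1 _

include hstar hsu hu0 hu hu' in
/-- **`T₁ f₀ = (c⁻¹ + (q − 1) + q⁴ c) f₀`** when the residue involution is non-trivial (`Q = q²`). -/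
theorem heckeSMul_cellU_one_eq_smul_inert
    (hIw : ∀ g : formUnitaryGroup (J3 u), ∃ n ∈ upperUnipotent u, ∃ m : ℤ, ∃ κ ∈ hyperspecialSubgroup R (J3 u),
      g = n * cellZ u hϖ hs m * κ)
    (htr : ∃ e : R, algebraMap R E e + star (algebraMap R E e) = 1)
    (hnt : ∃ t : IsLocalRing.ResidueField R, residueStar hstar hϖ hs t ≠ t)
    {c : k} {f₀ : formUnitaryGroup (J3 u) → k} (hf₀ : IsInduced u hϖ hs k c f₀)
    (hf₀K : f₀ ∈ LevelPositivity.invariants (rightRegular k) (hyperspecialSubgroup R (J3 u))) (h1 : f₀ 1 = 1) :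
    heckeSMul (rightRegular k) (doubleCosetOp k (hyperspecialSubgroup R (J3 u)) (cellU hϖ hs u 1)) ⟨f₀, hf₀K⟩ =
      (c⁻¹ + ((Nat.card (traceZero R E) : k) - 1) + (Nat.card (traceZero R E) : k) ^ 4 * c) • ⟨f₀, hf₀K⟩ := by
  rw [heckeSMul_cellU_one_eq_smul hstar u hsu hu0 hu hu' hϖ hs k hIw htr hf₀ hf₀K h1,
    card_residueField_eq_sq hstar hϖ hs htr hnt]
  congr 2
  push_cast
  ring

include hstar hsu hu0 hu hu' in
/-- **THE MACDONALD–SATAKE IDENTIFICATION**: for the unramified principal series with Satake parameter `α`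
(`c = (χ δ_B^{1/2})(a₁) = α q^{−2}`, `k` of characteristic `0`), the spherical vector satisfies
`T₁ f₀ = (q² (α + α⁻¹) + (q − 1)) f₀` — the `T₁`-eigenvalue is `S(T₁)` (file 213) evaluated at `α`. -/
theorem heckeSMul_cellU_one_eq_smul_param [CharZero k]
    (hIw : ∀ g : formUnitaryGroup (J3 u), ∃ n ∈ upperUnipotent u, ∃ m : ℤ, ∃ κ ∈ hyperspecialSubgroup R (J3 u),
      g = n * cellZ u hϖ hs m * κ)
    (htr : ∃ e : R, algebraMap R E e + star (algebraMap R E e) = 1)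
    (hnt : ∃ t : IsLocalRing.ResidueField R, residueStar hstar hϖ hs t ≠ t)
    {α : k} (hα : α ≠ 0) {f₀ : formUnitaryGroup (J3 u) → k}
    (hf₀ : IsInduced u hϖ hs k (α * ((Nat.card (traceZero R E) : k) ^ 2)⁻¹) f₀)
    (hf₀K : f₀ ∈ LevelPositivity.invariants (rightRegular k) (hyperspecialSubgroup R (J3 u))) (h1 : f₀ 1 = 1) :
    heckeSMul (rightRegular k) (doubleCosetOp k (hyperspecialSubgroup R (J3 u)) (cellU hϖ hs u 1)) ⟨f₀, hf₀K⟩ =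
      ((Nat.card (traceZero R E) : k) ^ 2 * (α + α⁻¹) + ((Nat.card (traceZero R E) : k) - 1)) • ⟨f₀, hf₀K⟩ := by
  rw [heckeSMul_cellU_one_eq_smul_inert hstar u hsu hu0 hu hu' hϖ hs k hIw htr hnt hf₀ hf₀K h1]
  congr 1
  have hq : (Nat.card (traceZero R E) : k) ≠ 0 := by exact_mod_cast (card_traceZero_pos (R := R) (E := E)).ne'
  field_simp
  ring

end Eigenvalue



end Summit.Ventures.HodgeRepro2.T5InertSphericalEigenvalue
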